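import Mathlib
import Literature.NumberTheory.Sieve.Maynard2016CoupledBox
import Literature.NumberTheory.Sieve.Maynard2016CoupledKernelWLimit
import HarnessLib

/-!
# Maynard (2016), Lemma 7, display (6.32): the weighted coupled sum as the integral of `K^w`

Topic `Literature/NumberTheory/Sieve`; trunk AntSieve / parity (Maynard 2016 large-gaps ladder, named
fact `Literature.NumberTheory.Sieve.Maynard2016.Lemma7Tuple` of `Maynard2016Lemma7PerTuple.lean`).

J. Maynard, *Large gaps between primes*, Ann. of Math. (2) 183 (2016), 915–933 = arXiv:1408.5110,
§6: (6.8)–(6.10) and Lemma 7 (6.32).  Port of `Maynard2016CoupledBox` to a general denominator weight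
`w` (`IsLcmWeight w` with `|w(n)| ≤ 1`, e.g. `w = 1/φ`: `PolymathLcmSumsEuler.isLcmWeight_totient_inv`):
the smoothed coupled sum `Σ [CoupledAdm] ∏ μμ F F' ∏ μμ G G' · w([d,d',e,e'])` (`coupledLcmSumW`)
equals `∫ Φ · K^w` (`coupledLcmSumW_eq_integral_freqKernel`), where `K^w = coupledFreqKernelW` is the
weighted kernel `coupledKernelW w` at the exponents `s(ξ)/log x, …`, `‖K^w‖ ≤ coupledKernelBoundW`.
The Fourier weight `coupledPhi` and the support box `supportBox` are those of `Maynard2016CoupledBox`.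

## References

* J. Maynard, *Large gaps between primes*, Ann. of Math. (2) 183 (2016), 915–933; arXiv:1408.5110,
  §6, (6.8)–(6.10) and (6.32). [Maynard2016LargeGaps]
-/

noncomputable section

open MeasureTheory Filter Finset Real
open scoped BigOperators Topology ArithmeticFunction.Moebius Classical

namespace Literature.NumberTheory.Sieve

namespace LcmEuler

variable {ι κ : Type*} [Fintype ι] [DecidableEq ι] [Fintype κ] [DecidableEq κ]

/-! ### The coupled sum with cutoffs -/

/-- The weighted `(d,d',e,e')`-term (Lemma 7's main term `S_i`, display before (6.32)):
`∏_i μ(d_i)μ(d'_i) F_i(log_x d_i) F'_i(log_x d'_i) · ∏_j μ(e_j)μ(e'_j) G_j(log_y e_j) G'_j(log_y e'_j) · w([d,d',e,e'])`.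
[cite: Maynard2016LargeGaps, §6 displays (6.8), (6.32)] -/
def coupledLcmTermW (w : ℕ → ℂ) (F F' : ι → ℝ → ℝ) (G G' : κ → ℝ → ℝ) (x y : ℝ) (tD : (ι → ℕ) × (ι → ℕ))
    (tE : (κ → ℕ) × (κ → ℕ)) : ℂ :=
  ((∏ i, (μ (tD.1 i) : ℂ) * μ (tD.2 i) * F i (Real.log (tD.1 i) / Real.log x) *
      F' i (Real.log (tD.2 i) / Real.log x)) *
    ∏ j, (μ (tE.1 j) : ℂ) * μ (tE.2 j) * G j (Real.log (tE.1 j) / Real.log y) *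
      G' j (Real.log (tE.2 j) / Real.log y)) *
    w (Nat.lcm (∏ i, Nat.lcm (tD.1 i) (tD.2 i)) (∏ j, Nat.lcm (tE.1 j) (tE.2 j)))

/-- The coupled sum (6.8) over the box `[1,D]^{2k₁} × [1,D]^{2k₂}` with the summation condition
`CoupledAdm W m M`. [cite: Maynard2016LargeGaps, §6 display (6.8)] -/
def coupledLcmSumW (w : ℕ → ℂ) (W m : ℕ) (M : ℕ → Finset (ι × κ)) (F F' : ι → ℝ → ℝ) (G G' : κ → ℝ → ℝ)
    (x y : ℝ) (D : ℕ) : ℂ :=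
  ∑ t ∈ (lcmBox ι D ×ˢ lcmBox ι D) ×ˢ (lcmBox κ D ×ˢ lcmBox κ D),
    if CoupledAdm W m M t.1 t.2 then coupledLcmTermW w F F' G G' x y t.1 t.2 else 0

/-! ### Frequencies, exponents and the Fourier weight -/

section Phi

variable {F F' : ι → ℝ → ℝ} {G G' : κ → ℝ → ℝ} {sF sF' : ι → ℝ} {sG sG' : κ → ℝ}

variable (hF : ∀ i, IsSieveCutoff (F i) (sF i)) (hF' : ∀ i, IsSieveCutoff (F' i) (sF' i))
  (hG : ∀ j, IsSieveCutoff (G j) (sG j)) (hG' : ∀ j, IsSieveCutoff (G' j) (sG' j))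

omit [DecidableEq ι] [DecidableEq κ] in
/-- The Fourier weight is continuous. [folklore] -/
private theorem continuous_coupledPhi : Continuous (coupledPhi hF hF' hG hG') :=
  ((continuous_fourierPhi hF hF').comp continuous_fst).mul
    ((continuous_fourierPhi hG hG').comp continuous_snd)

omit [DecidableEq ι] [DecidableEq κ] in
/-- The Fourier weight is integrable. [folklore] -/
private theorem integrable_coupledPhi : Integrable (coupledPhi hF hF' hG hG') :=
  (integrable_fourierPhi hF hF').mul_prod (integrable_fourierPhi hG hG')

omit [Fintype ι] [DecidableEq ι] [Fintype κ] [DecidableEq κ] in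
/-- The real parts of the exponents: `1/log x` on the `d`-side, `1/log y ≥ 1/log x` on the `e`-side
(`1 < y ≤ x`). [folklore] -/
private theorem re_exp_ge {x y : ℝ} (hy : 1 < y) (hyx : y ≤ x)
    (p : (ι → ℝ × ℝ) × (κ → ℝ × ℝ)) :
    (∀ i, 1 / Real.log x ≤ (expA x p.1 i).re ∧ 1 / Real.log x ≤ (expB x p.1 i).re) ∧
      ∀ j, 1 / Real.log x ≤ (expA y p.2 j).re ∧ 1 / Real.log x ≤ (expB y p.2 j).re := by
  have hlog : Real.log y ≤ Real.log x := Real.log_le_log (by linarith) hyx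
  have hly : 0 < Real.log y := Real.log_pos hy
  have hle : 1 / Real.log x ≤ 1 / Real.log y := one_div_le_one_div_of_le hly hlog
  refine ⟨fun i => ?_, fun j => ?_⟩
  · rw [(expA_re_expB_re x p.1 i).1, (expA_re_expB_re x p.1 i).2]
    exact ⟨le_rfl, le_rfl⟩
  · rw [(expA_re_expB_re y p.2 j).1, (expA_re_expB_re y p.2 j).2]
    exact ⟨hle, hle⟩

omit [Fintype ι] [DecidableEq ι] [Fintype κ] [DecidableEq κ] in
/-- `|μ(n) n^{-a}| ≤ 1` when `Re a ≥ 0`. [folklore] -/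
private theorem norm_moebiusWeight_le_one {α : Type*} {a : α → ℂ} (ha : ∀ i, 0 ≤ (a i).re) (i : α)
    (n : ℕ) : ‖moebiusWeight a i n‖ ≤ 1 := by
  rcases Nat.eq_zero_or_pos n with rfl | hn
  · simp [moebiusWeight]
  · refine (norm_moebius_mul_cpow_le n (a i)).trans ?_
    exact Real.rpow_le_one_of_one_le_of_nonpos (by exact_mod_cast hn) (by linarith [ha i])

omit [DecidableEq ι] [DecidableEq κ] in
/-- `|coupledEulerTerm| ≤ 1` when all exponents have non-negative real part. [folklore] -/
private theorem norm_coupledEulerTermW_le_one {w : ℕ → ℂ} (hw1 : ∀ n, ‖w n‖ ≤ 1) {W m : ℕ} {M : ℕ → Finset (ι × κ)} {a b : ι → ℂ}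
    {a' b' : κ → ℂ} (hab : ∀ i, 0 ≤ (a i).re ∧ 0 ≤ (b i).re)
    (hab' : ∀ j, 0 ≤ (a' j).re ∧ 0 ≤ (b' j).re)
    (t : ((ι → ℕ) × (ι → ℕ)) × ((κ → ℕ) × (κ → ℕ))) :
    ‖coupledEulerTermW w W m M a b a' b' t‖ ≤ 1 := by
  unfold coupledEulerTermW
  split_ifs
  · rw [coupledSummandW, norm_mul, norm_mul, norm_prod, norm_prod]
    have h1 : ∏ i, ‖moebiusWeight a i (t.1.1 i) * moebiusWeight b i (t.1.2 i)‖ ≤ 1 := by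
      refine Finset.prod_le_one (fun _ _ => norm_nonneg _) fun i _ => ?_
      rw [norm_mul]
      exact mul_le_one₀ (norm_moebiusWeight_le_one (fun i => (hab i).1) i _) (norm_nonneg _)
        (norm_moebiusWeight_le_one (fun i => (hab i).2) i _)
    have h2 : ∏ j, ‖moebiusWeight a' j (t.2.1 j) * moebiusWeight b' j (t.2.2 j)‖ ≤ 1 := by
      refine Finset.prod_le_one (fun _ _ => norm_nonneg _) fun j _ => ?_
      rw [norm_mul]
      exact mul_le_one₀ (norm_moebiusWeight_le_one (fun j => (hab' j).1) j _) (norm_nonneg _)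
        (norm_moebiusWeight_le_one (fun j => (hab' j).2) j _)
    have hnum : (∏ i, ‖moebiusWeight a i (t.1.1 i) * moebiusWeight b i (t.1.2 i)‖) *
        ∏ j, ‖moebiusWeight a' j (t.2.1 j) * moebiusWeight b' j (t.2.2 j)‖ ≤ 1 :=
      mul_le_one₀ h1 (Finset.prod_nonneg fun _ _ => norm_nonneg _) h2
    exact mul_le_one₀ hnum (norm_nonneg _) (hw1 _)
  · simp

omit [DecidableEq ι] [DecidableEq κ] in
/-- `p ↦ coupledEulerTerm(a(p), b(p), a'(p), b'(p), t)` is continuous when the entries of `t` are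
positive. [folklore] -/
private theorem continuous_coupledEulerTermW (w : ℕ → ℂ) (W m : ℕ) (M : ℕ → Finset (ι × κ)) (x y : ℝ)
    {t : ((ι → ℕ) × (ι → ℕ)) × ((κ → ℕ) × (κ → ℕ))}
    (ht : (∀ i, 0 < t.1.1 i ∧ 0 < t.1.2 i) ∧ ∀ j, 0 < t.2.1 j ∧ 0 < t.2.2 j) :
    Continuous fun p : (ι → ℝ × ℝ) × (κ → ℝ × ℝ) =>
      coupledEulerTermW w W m M (expA x p.1) (expB x p.1) (expA y p.2) (expB y p.2) t := by
  unfold coupledEulerTermW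
  by_cases hc : CoupledAdm W m M t.1 t.2
  · simp only [if_pos hc, coupledSummandW, moebiusWeight]
    refine (Continuous.mul ?_ ?_).mul continuous_const
    · refine continuous_finsetProd _ fun i _ => ?_
      exact (continuous_const.mul ((continuous_cpow_expA (ht.1 i).1 x i).comp continuous_fst)).mul
        (continuous_const.mul ((continuous_cpow_expB (ht.1 i).2 x i).comp continuous_fst))
    · refine continuous_finsetProd _ fun j _ => ?_
      exact (continuous_const.mul ((continuous_cpow_expA (ht.2 j).1 y j).comp continuous_snd)).mul
        (continuous_const.mul ((continuous_cpow_expB (ht.2 j).2 y j).comp continuous_snd))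
  · simp only [if_neg hc]
    exact continuous_const

/-! ### The term-wise Fourier substitution -/

omit [DecidableEq ι] in
/-- One side of the substitution: `∫ Φ(ξ,ξ') ∏_i μ(d_i) d_i^{-s(ξ_i)/log x} μ(d'_i) (d'_i)^{-s(ξ'_i)/log x}
= ∏_i μ(d_i)μ(d'_i) F_i(log_x d_i) F'_i(log_x d'_i)` (Polymath 8b p. 12 / Maynard (6.9)).
[cite: Maynard2016LargeGaps, §6 display (6.9)] -/
private theorem integral_fourierPhi_mul_prod_moebiusWeight {x : ℝ} (hx : 1 < x) (d d' : ι → ℕ)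
    (hd : ∀ i, 0 < d i) (hd' : ∀ i, 0 < d' i) :
    ∫ p : ι → ℝ × ℝ, fourierPhi hF hF' p *
        ∏ i, moebiusWeight (expA x p) i (d i) * moebiusWeight (expB x p) i (d' i) =
      ∏ i, (μ (d i) : ℂ) * μ (d' i) * F i (Real.log (d i) / Real.log x) *
        F' i (Real.log (d' i) / Real.log x) := by
  have hL : 0 < Real.log x := Real.log_pos hx
  set φ : ι → ℝ × ℝ → ℂ := fun i q =>
    ((hF i).fourierWeight q.1 * ((μ (d i) : ℂ) * (d i : ℂ) ^ (-(sOf q.1 / (Real.log x : ℂ))))) *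
      ((hF' i).fourierWeight q.2 * ((μ (d' i) : ℂ) * (d' i : ℂ) ^ (-(sOf q.2 / (Real.log x : ℂ)))))
    with hφ
  have hpt : ∀ p : ι → ℝ × ℝ, fourierPhi hF hF' p *
      ∏ i, moebiusWeight (expA x p) i (d i) * moebiusWeight (expB x p) i (d' i) = ∏ i, φ i (p i) := by
    intro p
    rw [fourierPhi, ← Finset.prod_mul_distrib]
    refine Finset.prod_congr rfl fun i _ => ?_
    simp only [hφ, expA, expB, moebiusWeight]
    ring
  simp_rw [hpt]
  rw [integral_fintype_prod_volume_eq_prod]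
  refine Finset.prod_congr rfl fun i _ => ?_
  have h1 : ∫ q : ℝ × ℝ, φ i q =
      (∫ ξ : ℝ, (hF i).fourierWeight ξ * ((μ (d i) : ℂ) * (d i : ℂ) ^ (-(sOf ξ / (Real.log x : ℂ))))) *
      (∫ ξ : ℝ, (hF' i).fourierWeight ξ * ((μ (d' i) : ℂ) * (d' i : ℂ) ^ (-(sOf ξ / (Real.log x : ℂ))))) := by
    simp only [hφ]
    rw [← integral_prod_mul]
    rfl
  have h2 : ∫ ξ : ℝ, (hF i).fourierWeight ξ * ((μ (d i) : ℂ) * (d i : ℂ) ^ (-(sOf ξ / (Real.log x : ℂ)))) =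
      (μ (d i) : ℂ) * F i (Real.log (d i) / Real.log x) := by
    rw [IsSieveCutoff.apply_log_div_eq_integral (hF i) (hd i) hL, ← integral_const_mul]
    refine integral_congr_ae (Eventually.of_forall fun ξ => ?_)
    beta_reduce; ring
  have h3 : ∫ ξ : ℝ, (hF' i).fourierWeight ξ * ((μ (d' i) : ℂ) * (d' i : ℂ) ^ (-(sOf ξ / (Real.log x : ℂ)))) =
      (μ (d' i) : ℂ) * F' i (Real.log (d' i) / Real.log x) := by
    rw [IsSieveCutoff.apply_log_div_eq_integral (hF' i) (hd' i) hL, ← integral_const_mul]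
    refine integral_congr_ae (Eventually.of_forall fun ξ => ?_)
    beta_reduce; ring
  rw [h1, h2, h3]
  ring

omit [DecidableEq ι] [DecidableEq κ] in
/-- **Substituting the Fourier expansions (6.9) into one term of (6.8)**: for positive entries,
`∫ Φ(p) · coupledEulerTerm_t(exponents(p)) dp = [the t-term of (6.8)]` (and `0` if the summation
condition fails). [cite: Maynard2016LargeGaps, §6 displays (6.9)–(6.10)] -/
theorem integral_coupledPhi_mul_coupledEulerTermW (w : ℕ → ℂ) (W m : ℕ) (M : ℕ → Finset (ι × κ)) {x y : ℝ}
    (hx : 1 < x) (hy : 1 < y) (tD : (ι → ℕ) × (ι → ℕ)) (tE : (κ → ℕ) × (κ → ℕ))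
    (htD : ∀ i, 0 < tD.1 i ∧ 0 < tD.2 i) (htE : ∀ j, 0 < tE.1 j ∧ 0 < tE.2 j) :
    ∫ p : (ι → ℝ × ℝ) × (κ → ℝ × ℝ), coupledPhi hF hF' hG hG' p *
        coupledEulerTermW w W m M (expA x p.1) (expB x p.1) (expA y p.2) (expB y p.2) (tD, tE) =
      if CoupledAdm W m M tD tE then coupledLcmTermW w F F' G G' x y tD tE else 0 := by
  by_cases hc : CoupledAdm W m M tD tE
  · rw [if_pos hc]
    set L : ℂ := w (Nat.lcm (∏ i, Nat.lcm (tD.1 i) (tD.2 i)) (∏ j, Nat.lcm (tE.1 j) (tE.2 j)))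
      with hLdef
    set A : (ι → ℝ × ℝ) → ℂ := fun p1 => fourierPhi hF hF' p1 *
      ∏ i, moebiusWeight (expA x p1) i (tD.1 i) * moebiusWeight (expB x p1) i (tD.2 i) with hA
    set B : (κ → ℝ × ℝ) → ℂ := fun p2 => fourierPhi hG hG' p2 *
      ∏ j, moebiusWeight (expA y p2) j (tE.1 j) * moebiusWeight (expB y p2) j (tE.2 j) with hB
    have hpt : ∀ p : (ι → ℝ × ℝ) × (κ → ℝ × ℝ), coupledPhi hF hF' hG hG' p *
        coupledEulerTermW w W m M (expA x p.1) (expB x p.1) (expA y p.2) (expB y p.2) (tD, tE) =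
        A p.1 * B p.2 * L := by
      intro p
      rw [coupledEulerTermW]
      simp only
      rw [if_pos hc, coupledSummandW, coupledPhi, hA, hB, hLdef]
      ring
    simp_rw [hpt]
    have hAB : ∫ p : (ι → ℝ × ℝ) × (κ → ℝ × ℝ), A p.1 * B p.2 = (∫ p1, A p1) * ∫ p2, B p2 := by
      rw [← integral_prod_mul]
      rfl
    rw [integral_mul_const, hAB, hA, hB,
      integral_fourierPhi_mul_prod_moebiusWeight hF hF' hx tD.1 tD.2 (fun i => (htD i).1)
        (fun i => (htD i).2),
      integral_fourierPhi_mul_prod_moebiusWeight hG hG' hy tE.1 tE.2 (fun j => (htE j).1)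
        (fun j => (htE j).2), coupledLcmTermW]
  · rw [if_neg hc]
    have hpt : ∀ p : (ι → ℝ × ℝ) × (κ → ℝ × ℝ), coupledPhi hF hF' hG hG' p *
        coupledEulerTermW w W m M (expA x p.1) (expB x p.1) (expA y p.2) (expB y p.2) (tD, tE) = 0 := by
      intro p
      rw [coupledEulerTermW]
      simp only
      rw [if_neg hc, mul_zero]
    simp_rw [hpt]
    exact integral_zero _ _

/-! ### The sum over a box as an integral -/

/-- The coupled kernel summed over the box `[1,D]^{2k₁} × [1,D]^{2k₂}` at the exponents
`s(ξ_i)/log x, s(ξ'_i)/log x, s(τ_j)/log y, s(τ'_j)/log y`. [cite: Maynard2016LargeGaps, §6 display (6.10)] -/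
def coupledBoxKernelW (w : ℕ → ℂ) (W m : ℕ) (M : ℕ → Finset (ι × κ)) (x y : ℝ) (D : ℕ)
    (p : (ι → ℝ × ℝ) × (κ → ℝ × ℝ)) : ℂ :=
  ∑ t ∈ (lcmBox ι D ×ˢ lcmBox ι D) ×ˢ (lcmBox κ D ×ˢ lcmBox κ D),
    coupledEulerTermW w W m M (expA x p.1) (expB x p.1) (expA y p.2) (expB y p.2) t

/-- Entries of the box are positive. [folklore] -/
private theorem pos_of_mem_box {D : ℕ} {t : ((ι → ℕ) × (ι → ℕ)) × ((κ → ℕ) × (κ → ℕ))}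
    (ht : t ∈ (lcmBox ι D ×ˢ lcmBox ι D) ×ˢ (lcmBox κ D ×ˢ lcmBox κ D)) :
    (∀ i, 0 < t.1.1 i ∧ 0 < t.1.2 i) ∧ ∀ j, 0 < t.2.1 j ∧ 0 < t.2.2 j := by
  simp only [Finset.mem_product] at ht
  exact ⟨fun i => ⟨pos_of_mem_lcmBox ht.1.1 i, pos_of_mem_lcmBox ht.1.2 i⟩,
    fun j => ⟨pos_of_mem_lcmBox ht.2.1 j, pos_of_mem_lcmBox ht.2.2 j⟩⟩

/-- The box kernel is continuous in the frequencies. [folklore] -/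
private theorem continuous_coupledBoxKernelW (w : ℕ → ℂ) (W m : ℕ) (M : ℕ → Finset (ι × κ)) (x y : ℝ) (D : ℕ) :
    Continuous (coupledBoxKernelW (ι := ι) (κ := κ) w W m M x y D) := by
  unfold coupledBoxKernelW
  refine continuous_finsetSum _ fun t ht => ?_
  exact continuous_coupledEulerTermW w W m M x y (pos_of_mem_box ht)

/-- `‖box kernel‖ ≤ coupledKernelBound k₁ k₂ (1/log x)` uniformly in `D` and the frequencies
(`1 < y ≤ x`). [cite: Maynard2016LargeGaps, §6 (proof of Lemma 6, after (6.11))] -/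
theorem norm_coupledBoxKernelW_le {w : ℕ → ℂ} (hw : IsLcmWeight w) (W m : ℕ) (M : ℕ → Finset (ι × κ)) {x y : ℝ} (hy : 1 < y)
    (hyx : y ≤ x) (D : ℕ) (p : (ι → ℝ × ℝ) × (κ → ℝ × ℝ)) :
    ‖coupledBoxKernelW w W m M x y D p‖ ≤
      coupledKernelBoundW (Fintype.card ι) (Fintype.card κ) (1 / Real.log x) :=
  norm_sum_coupledEulerTermW_le hw M (one_div_pos.2 (Real.log_pos (lt_of_lt_of_le hy hyx)))
    (re_exp_ge hy hyx p).1 (re_exp_ge hy hyx p).2 _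

/-- **(6.8) over the box equals `∫ Φ · (box kernel)`** (finite sum of the term-wise substitutions).
[cite: Maynard2016LargeGaps, §6 displays (6.9)–(6.10)] -/
theorem coupledLcmSumW_eq_integral_boxKernel {w : ℕ → ℂ} (hw1 : ∀ n, ‖w n‖ ≤ 1) (W m : ℕ) (M : ℕ → Finset (ι × κ)) {x y : ℝ}
    (hx : 1 < x) (hy : 1 < y) (D : ℕ) :
    coupledLcmSumW w W m M F F' G G' x y D =
      ∫ p : (ι → ℝ × ℝ) × (κ → ℝ × ℝ), coupledPhi hF hF' hG hG' p * coupledBoxKernelW w W m M x y D p := by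
  have hre : ∀ p : (ι → ℝ × ℝ) × (κ → ℝ × ℝ),
      (∀ i, 0 ≤ (expA x p.1 i).re ∧ 0 ≤ (expB x p.1 i).re) ∧
        ∀ j, 0 ≤ (expA y p.2 j).re ∧ 0 ≤ (expB y p.2 j).re := by
    intro p
    have hlx : 0 ≤ 1 / Real.log x := (one_div_pos.2 (Real.log_pos hx)).le
    have hly : 0 ≤ 1 / Real.log y := (one_div_pos.2 (Real.log_pos hy)).le
    refine ⟨fun i => ?_, fun j => ?_⟩
    · rw [(expA_re_expB_re x p.1 i).1, (expA_re_expB_re x p.1 i).2]; exact ⟨hlx, hlx⟩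
    · rw [(expA_re_expB_re y p.2 j).1, (expA_re_expB_re y p.2 j).2]; exact ⟨hly, hly⟩
  have hint : ∀ t ∈ (lcmBox ι D ×ˢ lcmBox ι D) ×ˢ (lcmBox κ D ×ˢ lcmBox κ D),
      Integrable fun p : (ι → ℝ × ℝ) × (κ → ℝ × ℝ) => coupledPhi hF hF' hG hG' p *
        coupledEulerTermW w W m M (expA x p.1) (expB x p.1) (expA y p.2) (expB y p.2) t := by
    intro t ht
    have h := (integrable_coupledPhi hF hF' hG hG').bdd_mul (c := 1)
      (continuous_coupledEulerTermW w W m M x y (pos_of_mem_box ht)).aestronglyMeasurable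
      (ae_of_all _ fun p => norm_coupledEulerTermW_le_one hw1 (hre p).1 (hre p).2 t)
    exact h.congr (ae_of_all _ fun p => mul_comm _ _)
  unfold coupledLcmSumW coupledBoxKernelW
  simp_rw [Finset.mul_sum]
  rw [integral_finsetSum _ hint]
  refine Finset.sum_congr rfl fun t ht => ?_
  obtain ⟨htD, htE⟩ := pos_of_mem_box ht
  exact (integral_coupledPhi_mul_coupledEulerTermW hF hF' hG hG' w W m M hx hy t.1 t.2 htD htE).symm

/-! ### Beyond the supports the sum does not change -/

omit [DecidableEq ι] [DecidableEq κ] in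
include hF hF' hG hG' in
/-- A term vanishes as soon as some `d_i` or `d'_i` exceeds `x^{T_F}` or some `e_j` or `e'_j` exceeds
`y^{T_G}` (the cutoffs vanish there). [folklore] -/
private theorem coupledLcmTermW_eq_zero_of_lt (w : ℕ → ℂ) {x y T_F T_G : ℝ} (hx : 1 < x) (hy : 1 < y)
    (hTF : ∀ i, sF i ≤ T_F ∧ sF' i ≤ T_F) (hTG : ∀ j, sG j ≤ T_G ∧ sG' j ≤ T_G)
    {tD : (ι → ℕ) × (ι → ℕ)} {tE : (κ → ℕ) × (κ → ℕ)}
    (h : (∃ i, x ^ T_F < tD.1 i ∨ x ^ T_F < tD.2 i) ∨ ∃ j, y ^ T_G < tE.1 j ∨ y ^ T_G < tE.2 j) :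
    coupledLcmTermW w F F' G G' x y tD tE = 0 := by
  have hLx : 0 < Real.log x := Real.log_pos hx
  have hLy : 0 < Real.log y := Real.log_pos hy
  have hx0 : 0 < x := by linarith
  have hy0 : 0 < y := by linarith
  have hlogx : ∀ {n : ℕ}, x ^ T_F < n → T_F < Real.log n / Real.log x := by
    intro n hn
    rw [lt_div_iff₀ hLx, ← Real.log_rpow hx0]
    exact Real.log_lt_log (Real.rpow_pos_of_pos hx0 T_F) hn
  have hlogy : ∀ {n : ℕ}, y ^ T_G < n → T_G < Real.log n / Real.log y := by
    intro n hn
    rw [lt_div_iff₀ hLy, ← Real.log_rpow hy0]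
    exact Real.log_lt_log (Real.rpow_pos_of_pos hy0 T_G) hn
  unfold coupledLcmTermW
  rcases h with ⟨i, hi | hi⟩ | ⟨j, hj | hj⟩
  · rw [Finset.prod_eq_zero (Finset.mem_univ i) ?_]
    · simp
    · rw [(hF i).eq_zero _ (lt_of_le_of_lt (hTF i).1 (hlogx hi))]; simp
  · rw [Finset.prod_eq_zero (Finset.mem_univ i) ?_]
    · simp
    · rw [(hF' i).eq_zero _ (lt_of_le_of_lt (hTF i).2 (hlogx hi))]; simp
  · rw [Finset.prod_eq_zero (Finset.mem_univ j) ?_]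
    · simp
    · rw [(hG j).eq_zero _ (lt_of_le_of_lt (hTG j).1 (hlogy hj))]; simp
  · rw [Finset.prod_eq_zero (Finset.mem_univ j) ?_]
    · simp
    · rw [(hG' j).eq_zero _ (lt_of_le_of_lt (hTG j).2 (hlogy hj))]; simp

omit [Fintype ι] [DecidableEq ι] [Fintype κ] [DecidableEq κ] in
/-- A natural number beyond `D ≥ D₀` exceeds both `x^{T_F}` and `y^{T_G}`. [folklore] -/
private theorem lt_of_supportBox_lt {x y T_F T_G : ℝ} (hx : 0 ≤ x) (hy : 0 ≤ y) {D n : ℕ}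
    (hD : supportBox x y T_F T_G ≤ D) (hn : D < n) : x ^ T_F < n ∧ y ^ T_G < n := by
  have h1 : ⌊x ^ T_F⌋₊ < n := lt_of_le_of_lt ((le_max_left _ _).trans hD) hn
  have h2 : ⌊y ^ T_G⌋₊ < n := lt_of_le_of_lt ((le_max_right _ _).trans hD) hn
  exact ⟨(Nat.floor_lt (Real.rpow_nonneg hx _)).1 h1, (Nat.floor_lt (Real.rpow_nonneg hy _)).1 h2⟩

include hF hF' hG hG' in
/-- **Beyond `D₀ = max ⌊x^{T_F}⌋ ⌊y^{T_G}⌋` the coupled sum does not change.** [cite: Maynard2016LargeGaps, §6 display (6.8)] -/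
theorem coupledLcmSumW_eq_of_le (w : ℕ → ℂ) (W m : ℕ) (M : ℕ → Finset (ι × κ)) {x y T_F T_G : ℝ} (hx : 1 < x)
    (hy : 1 < y) (hTF : ∀ i, sF i ≤ T_F ∧ sF' i ≤ T_F) (hTG : ∀ j, sG j ≤ T_G ∧ sG' j ≤ T_G)
    {D D' : ℕ} (hD : supportBox x y T_F T_G ≤ D) (hDD' : D ≤ D') :
    coupledLcmSumW w W m M F F' G G' x y D' = coupledLcmSumW w W m M F F' G G' x y D := by
  have hx0 : 0 ≤ x := by linarith
  have hy0 : 0 ≤ y := by linarith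
  unfold coupledLcmSumW
  symm
  have hsub : (lcmBox ι D ×ˢ lcmBox ι D) ×ˢ (lcmBox κ D ×ˢ lcmBox κ D) ⊆
      (lcmBox ι D' ×ˢ lcmBox ι D') ×ˢ (lcmBox κ D' ×ˢ lcmBox κ D') :=
    Finset.product_subset_product (Finset.product_subset_product (lcmBox_mono hDD') (lcmBox_mono hDD'))
      (Finset.product_subset_product (lcmBox_mono hDD') (lcmBox_mono hDD'))
  refine Finset.sum_subset hsub fun t ht hnot => ?_
  -- some coordinate of `t` exceeds `D`
  have hout : (∃ i, D < t.1.1 i ∨ D < t.1.2 i) ∨ ∃ j, D < t.2.1 j ∨ D < t.2.2 j := by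
    by_contra hcon
    simp only [not_or, not_exists, not_lt] at hcon
    apply hnot
    simp only [Finset.mem_product, lcmBox, Fintype.mem_piFinset, Finset.mem_Icc] at ht ⊢
    exact ⟨⟨fun i => ⟨(ht.1.1 i).1, (hcon.1 i).1⟩, fun i => ⟨(ht.1.2 i).1, (hcon.1 i).2⟩⟩,
      fun j => ⟨(ht.2.1 j).1, (hcon.2 j).1⟩, fun j => ⟨(ht.2.2 j).1, (hcon.2 j).2⟩⟩
  have hbig : (∃ i, x ^ T_F < t.1.1 i ∨ x ^ T_F < t.1.2 i) ∨
      ∃ j, y ^ T_G < t.2.1 j ∨ y ^ T_G < t.2.2 j := by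
    rcases hout with ⟨i, hi | hi⟩ | ⟨j, hj | hj⟩
    · exact Or.inl ⟨i, Or.inl (lt_of_supportBox_lt hx0 hy0 hD hi).1⟩
    · exact Or.inl ⟨i, Or.inr (lt_of_supportBox_lt hx0 hy0 hD hi).1⟩
    · exact Or.inr ⟨j, Or.inl (lt_of_supportBox_lt hx0 hy0 hD hj).2⟩
    · exact Or.inr ⟨j, Or.inr (lt_of_supportBox_lt hx0 hy0 hD hj).2⟩
  rw [coupledLcmTermW_eq_zero_of_lt hF hF' hG hG' w hx hy hTF hTG hbig, ite_self]

/-! ### The representation (6.10): the sum as the integral of the kernel -/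

/-- The coupled kernel `K` of (6.10) at the exponents `s(ξ_i)/log x`, `s(ξ'_i)/log x`, `s(τ_j)/log y`,
`s(τ'_j)/log y`. [cite: Maynard2016LargeGaps, §6 display (6.10)] -/
def coupledFreqKernelW (w : ℕ → ℂ) (W m : ℕ) (M : ℕ → Finset (ι × κ)) (x y : ℝ)
    (p : (ι → ℝ × ℝ) × (κ → ℝ × ℝ)) : ℂ :=
  coupledKernelW w W m M (expA x p.1) (expB x p.1) (expA y p.2) (expB y p.2)

/-- Box kernels tend to `K` pointwise as `D → ∞` (`1 < y ≤ x`). [cite: Maynard2016LargeGaps, §6 displays (6.8)–(6.10)] -/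
theorem tendsto_coupledBoxKernelW {w : ℕ → ℂ} (hw : IsLcmWeight w) (W m : ℕ) (M : ℕ → Finset (ι × κ)) {x y : ℝ} (hy : 1 < y)
    (hyx : y ≤ x) (p : (ι → ℝ × ℝ) × (κ → ℝ × ℝ)) :
    Tendsto (fun D : ℕ => coupledBoxKernelW w W m M x y D p) atTop
      (𝓝 (coupledFreqKernelW w W m M x y p)) :=
  tendsto_sum_box_coupledEulerTermW hw M (one_div_pos.2 (Real.log_pos (lt_of_lt_of_le hy hyx)))
    (re_exp_ge hy hyx p).1 (re_exp_ge hy hyx p).2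

/-- `K` is a.e.-strongly measurable in the frequencies. [folklore] -/
private theorem aestronglyMeasurable_coupledFreqKernelW {w : ℕ → ℂ} (hw : IsLcmWeight w) (W m : ℕ) (M : ℕ → Finset (ι × κ))
    {x y : ℝ} (hy : 1 < y) (hyx : y ≤ x) :
    AEStronglyMeasurable (coupledFreqKernelW (ι := ι) (κ := κ) w W m M x y) volume :=
  aestronglyMeasurable_of_tendsto_ae atTop
    (fun D => (continuous_coupledBoxKernelW w W m M x y D).aestronglyMeasurable)
    (ae_of_all _ fun p => tendsto_coupledBoxKernelW hw W m M hy hyx p)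

/-- **`∏_p K_p ≪ (log x)^{O_k(1)}`**: `‖K(p)‖ ≤ coupledKernelBound k₁ k₂ (1/log x)` for all
frequencies. [cite: Maynard2016LargeGaps, §6 (proof of Lemma 6, after (6.11))] -/
theorem norm_coupledFreqKernelW_le {w : ℕ → ℂ} (hw : IsLcmWeight w) (W m : ℕ) (M : ℕ → Finset (ι × κ)) {x y : ℝ} (hy : 1 < y)
    (hyx : y ≤ x) (p : (ι → ℝ × ℝ) × (κ → ℝ × ℝ)) :
    ‖coupledFreqKernelW w W m M x y p‖ ≤
      coupledKernelBoundW (Fintype.card ι) (Fintype.card κ) (1 / Real.log x) :=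
  norm_coupledKernelW_le hw M (one_div_pos.2 (Real.log_pos (lt_of_lt_of_le hy hyx)))
    (re_exp_ge hy hyx p).1 (re_exp_ge hy hyx p).2

/-- `Φ · K` is integrable ("the expression is absolutely convergent"). [cite: Maynard2016LargeGaps, §6 display (6.10)] -/
theorem integrable_coupledPhi_mul_freqKernelW {w : ℕ → ℂ} (hw : IsLcmWeight w) (W m : ℕ) (M : ℕ → Finset (ι × κ)) {x y : ℝ}
    (hy : 1 < y) (hyx : y ≤ x) :
    Integrable fun p : (ι → ℝ × ℝ) × (κ → ℝ × ℝ) =>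
      coupledPhi hF hF' hG hG' p * coupledFreqKernelW w W m M x y p := by
  have h := (integrable_coupledPhi hF hF' hG hG').bdd_mul
    (c := coupledKernelBoundW (Fintype.card ι) (Fintype.card κ) (1 / Real.log x))
    (aestronglyMeasurable_coupledFreqKernelW hw W m M hy hyx)
    (ae_of_all _ fun p => norm_coupledFreqKernelW_le hw W m M hy hyx p)
  exact h.congr (ae_of_all _ fun p => mul_comm _ _)

/-- **(6.10): the coupled sum (6.8) equals `∫ Φ · K`** ("Here we have swapped the order of summation
and integration (which is valid because the expression is absolutely convergent)", p. 10).  The sum is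
over the box of size `D₀ = max ⌊x^{T_F}⌋ ⌊y^{T_G}⌋` bounding the supports (which is the full sum,
`coupledLcmSum_eq_of_le`), and the passage to the infinite kernel is by dominated convergence.
[cite: Maynard2016LargeGaps, §6 display (6.10)] -/
theorem coupledLcmSumW_eq_integral_freqKernel {w : ℕ → ℂ} (hw : IsLcmWeight w) (hw1 : ∀ n, ‖w n‖ ≤ 1) (W m : ℕ) (M : ℕ → Finset (ι × κ))
    {x y T_F T_G : ℝ} (hy : 1 < y) (hyx : y ≤ x) (hTF : ∀ i, sF i ≤ T_F ∧ sF' i ≤ T_F)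
    (hTG : ∀ j, sG j ≤ T_G ∧ sG' j ≤ T_G) {D : ℕ} (hD : supportBox x y T_F T_G ≤ D) :
    coupledLcmSumW w W m M F F' G G' x y D =
      ∫ p : (ι → ℝ × ℝ) × (κ → ℝ × ℝ), coupledPhi hF hF' hG hG' p * coupledFreqKernelW w W m M x y p := by
  have hx : 1 < x := lt_of_lt_of_le hy hyx
  -- the box sums tend to the kernel integral by dominated convergence
  have hlim : Tendsto (fun D' : ℕ => ∫ p : (ι → ℝ × ℝ) × (κ → ℝ × ℝ),
      coupledPhi hF hF' hG hG' p * coupledBoxKernelW w W m M x y D' p) atTop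
      (𝓝 (∫ p : (ι → ℝ × ℝ) × (κ → ℝ × ℝ),
        coupledPhi hF hF' hG hG' p * coupledFreqKernelW w W m M x y p)) := by
    refine tendsto_integral_of_dominated_convergence
      (fun p => ‖coupledPhi hF hF' hG hG' p‖ *
        coupledKernelBoundW (Fintype.card ι) (Fintype.card κ) (1 / Real.log x))
      (fun D' => ((continuous_coupledPhi hF hF' hG hG').mul
        (continuous_coupledBoxKernelW w W m M x y D')).aestronglyMeasurable)
      ((integrable_coupledPhi hF hF' hG hG').norm.mul_const _)
      (fun D' => ae_of_all _ fun p => ?_)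
      (ae_of_all _ fun p => (tendsto_coupledBoxKernelW hw W m M hy hyx p).const_mul _)
    rw [norm_mul]
    exact mul_le_mul_of_nonneg_left (norm_coupledBoxKernelW_le hw W m M hy hyx D' p) (norm_nonneg _)
  -- while they are eventually constant
  have hconst : Tendsto (fun D' : ℕ => ∫ p : (ι → ℝ × ℝ) × (κ → ℝ × ℝ),
      coupledPhi hF hF' hG hG' p * coupledBoxKernelW w W m M x y D' p) atTop
      (𝓝 (coupledLcmSumW w W m M F F' G G' x y D)) := by
    refine tendsto_const_nhds.congr' ?_
    filter_upwards [eventually_ge_atTop D] with D' hD'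
    rw [← coupledLcmSumW_eq_integral_boxKernel hF hF' hG hG' hw1 W m M hx hy D',
      coupledLcmSumW_eq_of_le hF hF' hG hG' w W m M hx hy hTF hTG hD hD']
  exact tendsto_nhds_unique hconst hlim

end Phi

end LcmEuler

end Literature.NumberTheory.Sieve

end
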